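import Mathlib

/-!
# Strip theorem endgame, level-restricted form

Support file for crux item `stmt-MatrixMultiplication-10752`
(`Summit.MatrixMultiplication.MatrixMultiplication.Theses.HiddenToeplitzCorners.HiddenCornerLemmaR`),
line `frobenius-dual-short-syzygies`, assembly of the strip case of `stub_gconstDualLaw`
(paper proof `math/STRIP_THEOREM.md`, §3 endgame).  This is the variant of the landed
`hclR_strip_endgame` in which the junk-row hypothesis (II) is only assumed at levels `wstar ≥ 1`
(the only levels at which the assembly can supply it: at `wstar = 0` the junk rows of adjacent
strips overlap); the proof is the same elementary arithmetic.
-/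

set_option linter.dupNamespace false

namespace Summit.MatrixMultiplication.MatrixMultiplication.Theorems

/-! ### The endgame with the level restricted to `wstar ≥ 1` -/

set_option linter.unusedVariables false in
/-- The endgame arithmetic of the strip theorem (variant of `hclR_strip_endgame` in which the
junk-row hypothesis (II) is only required at levels `wstar ≥ 1`, which is all the proof uses). -/
theorem hclR_strip_endgame_pos : ∀ (p r N : ℕ) (w : Fin p → ℕ) (cap kap : ℕ → ℕ) (hr : 2 ≤ r) (hw : ∀ k, 1 ≤ w k) (hN : ∑ k, w k = N) (hI : ∀ j, 1 ≤ j → 0 < cap j → r * (cap j + j) ≤ 2 * kap j) (hMono : ∀ j j', j ≤ j' → cap j = 0 → cap j' = 0) (hC : r ≤ ∑ k, cap (w k)) (hII : ∀ wstar : ℕ, 1 ≤ wstar → (∀ k, cap (w k) = 0 → wstar ≤ w k) → (∑ k ∈ Finset.univ.filter (fun k => cap (w k) = 0), (w k + 1 - wstar)) + kap wstar ≤ N), r ≤ 2 * p - 1 := by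
  intro p r N w cap kap hr hw hN hI hMono hC hII
  classical
  set J : Finset (Fin p) := Finset.univ.filter (fun k => cap (w k) = 0) with hJdef
  set K' : Finset (Fin p) := Finset.univ.filter (fun k => ¬ cap (w k) = 0) with hK'def
  have hmemJ : ∀ k, k ∈ J ↔ cap (w k) = 0 := fun k => by simp [hJdef]
  have hmemK' : ∀ k, k ∈ K' ↔ ¬ cap (w k) = 0 := fun k => by simp [hK'def]
  have hK'ne : K'.Nonempty := by
    by_contra h
    rw [Finset.not_nonempty_iff_eq_empty] at h
    have hzero : ∑ k, cap (w k) = 0 := by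
      refine Finset.sum_eq_zero (fun k _ => ?_)
      by_contra hk
      have hk' : k ∈ K' := (hmemK' k).2 hk
      rw [h] at hk'
      simp at hk'
    omega
  obtain ⟨k₀, hk₀K', hk₀max⟩ := Finset.exists_max_image K' w hK'ne
  set ws : ℕ := w k₀ with hws
  have hk₀ : ¬ cap ws = 0 := (hmemK' k₀).1 hk₀K'
  have hws1 : 1 ≤ ws := hw k₀
  have hprem : ∀ k, cap (w k) = 0 → ws ≤ w k := by
    intro k hk
    by_contra hlt
    exact hk₀ (hMono (w k) ws (not_le.mp hlt).le hk)
  have h1 : r * (cap ws + ws) ≤ 2 * kap ws := hI ws hws1 (Nat.pos_of_ne_zero hk₀)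
  have h2 : (∑ k ∈ J, (w k + 1 - ws)) + kap ws ≤ N := hII ws hws1 hprem
  have hsplit : (∑ k ∈ J, w k) + ∑ k ∈ K', w k = N := by
    rw [← hN]
    exact Finset.sum_filter_add_sum_filter_not _ _ _
  have hJsum : (∑ k ∈ J, (w k + 1 - ws)) + J.card * ws = (∑ k ∈ J, w k) + J.card := by
    have hterm : ∀ k ∈ J, (w k + 1 - ws) + ws = w k + 1 := by
      intro k hk
      have := hprem k ((hmemJ k).1 hk)
      omega
    calc (∑ k ∈ J, (w k + 1 - ws)) + J.card * ws
        = ∑ k ∈ J, ((w k + 1 - ws) + ws) := by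
          rw [Finset.sum_add_distrib, Finset.sum_const, smul_eq_mul]
      _ = ∑ k ∈ J, (w k + 1) := Finset.sum_congr rfl hterm
      _ = (∑ k ∈ J, w k) + J.card := by
          rw [Finset.sum_add_distrib, Finset.sum_const, smul_eq_mul, mul_one]
  have hK'sum : ∑ k ∈ K', w k ≤ K'.card * ws := by
    have := Finset.sum_le_card_nsmul K' w ws (fun k hk => hk₀max k hk)
    simpa using this
  have hcard : J.card + K'.card = p := by
    have := Finset.card_filter_add_card_filter_not (s := (Finset.univ : Finset (Fin p)))
      (fun k => cap (w k) = 0)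
    simpa using this
  have hp : 1 ≤ p := by
    have := hK'ne.card_pos
    omega
  have h3 : kap ws + J.card ≤ K'.card * ws + J.card * ws := by omega
  have h4 : K'.card * ws + J.card * ws = p * ws := by rw [← add_mul, add_comm, hcard]
  have h5 : r * (ws + 1) ≤ r * (cap ws + ws) := Nat.mul_le_mul_left r (by omega)
  have h6 : r * (ws + 1) ≤ 2 * p * ws := by
    have : 2 * kap ws ≤ 2 * (p * ws) := by omega
    calc r * (ws + 1) ≤ r * (cap ws + ws) := h5
      _ ≤ 2 * kap ws := h1
      _ ≤ 2 * (p * ws) := this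
      _ = 2 * p * ws := by ring
  have h7 : r < 2 * p := by
    by_contra hge'
    have hge : 2 * p ≤ r := not_lt.mp hge'
    have h8 : 2 * p * (ws + 1) ≤ r * (ws + 1) := Nat.mul_le_mul_right (ws + 1) hge
    nlinarith
  omega

end Summit.MatrixMultiplication.MatrixMultiplication.Theorems
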